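import Summits.NavierStokesRegularity.NavierStokesRegularity.Theses.AxisymmetricExtremality
import Summits.NavierStokesRegularity.NavierStokesRegularity.Theorems.AxisymmetricExtremalityAxisymmetricKatoGlobalStubSereginLogSwirlOriginTopTimePartialRegularity
import Literature.Analysis.FluidPDE.Seregin2020SingularSetAxis
import Literature.Analysis.FluidPDE.ESSLocalHolderBlowupLimit
import Literature.Analysis.FluidPDE.RusinSverakBackwardRegularityHolds
import Literature.Analysis.FluidPDE.SingularSetRescaling
import Literature.Analysis.FluidPDE.SuitableWeakProofs
import Literature.Analysis.FluidPDE.EulerTimeScaling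
import HarnessLib

/-!
# Seregin 2020, proof of Thm 2.1, the no-swirl endgame: structure of the backward-singular set
# of a local energy ancient solution (closed, on the axis, `𝒫¹`-null)

Helper toward the stub `stub_seregin2020TypeII` of the crux `AxisymmetricKatoGlobal` (= the named
fact `Literature.Analysis.FluidPDE.Seregin2020_axisymmetricSingularPoint_typeII`, G. Seregin,
Anal. Math. Phys. 10 (2020) Paper 46 = arXiv:2006.04140, Thm 2.1). For the blow-up limit `u`
with property (𝒜) the printed proof records (arXiv p. 7): "Since `u` and `p` is an axially
symmetric suitable weak solution, there exists a closed set `S^Γ` in `Q₋`, whose 1D-parabolic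
measure … is equal to zero and `x' = 0` for any `z = (x', x₃, t) ∈ S^Γ`, such that any spatial
derivative of `u` … is Hölder continuous in `Q₋ ∖ S^Γ`", and the no-swirl endgame (p. 8) removes
the remaining axis singularities up to the TOP time `t = 0` ("`u` is a continuous function in
`Q̄(R)`"). This file proves the structure statement for the set that matters for the endgame, the
BACKWARD-singular set up to the top time,
`Σ = {z = (t, x) | t ≤ 0, u ∉ L_∞(Q(z, r)) for every r > 0}`,
of any pair `(w, π)` which is an Albritton–Barker suitable weak solution in every `Q(a)`, `a > 0`,
with axisymmetric slices ((𝒜)(i)–(ii)): `Σ` is closed, contained in the axis, and `𝒫¹`-null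
(`ancientLimit_backwardSingular_structure`). With the sibling
`exists_clean_first_singular_point_of_isParabolicNull` this yields, at any point of `Σ`, a first
singular point with a clean parabolic past — the configuration of the `η = ω_φ/ϱ` maximum
principle.

Proof: the class is invariant under the parabolic dilations `w ↦ b w(b² s, b y)` about the
origin (`IsSuitableWeakSolutionInBall.zoomOut`), and at scale `2` it restricts to the hypothesis
block of Seregin's local theorems on the unit coordinate cylinder `𝒞 × ]-1, 0[`
(`parCyl_block_of_inBall`); every point of the closed lower half space is brought into
`𝒞 × ]-1, 0]` by a dilation, and backward boundedness is dilation invariant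
(`eLpNorm_top_nsZoom`). Hence: off-axis points are backward regular up to the top
(`Seregin2020.offAxis_regular`); `Σ` is a countable union of dilated images of the `𝒫¹`-null sets
of `isParabolicNull_backwardSingular_top` (`IsParabolicNull.image_stAffine`,
`parabolicHausdorff_iUnion_le_holds`); closedness follows from the centred regularity of
backward-bounded interior points (`isRegularPoint_of_eLpNorm_parabolicCylinder_lt_top_holds`) and,
at the top time, from the nesting `Q(z', r/2) ⊆ Q(z, r)` for `t' ≤ t`.

## References

* G. Seregin, Anal. Math. Phys. 10 (2020), Paper 46 = arXiv:2006.04140, proof of Thm. 2.1,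
  structure of `S^Γ` (arXiv p. 7) and last paragraph (p. 8). [Seregin2020]
* L. Caffarelli, R. Kohn, L. Nirenberg, Comm. Pure Appl. Math. 35 (1982), Theorem B.
  [CaffarelliKohnNirenberg1982]
-/

-- the problem directory repeats the summit name (D-0017); core's `dupNamespace` linter fires
set_option linter.dupNamespace false

noncomputable section

open MeasureTheory Set Function Filter Topology TopologicalSpace Metric
open scoped NNReal ENNReal

namespace Summit.NavierStokesRegularity.NavierStokesRegularity.Theorems.AxisymmetricKatoGlobal.EulerScaling

open Literature.Analysis.FluidPDE Literature.Analysis.FluidPDE.Seregin2020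
  Literature.Analysis.FluidPDE.SereginSverak2009

/-! ### From the ball class at scale `2` to the unit coordinate cylinder -/

/-- `𝒞 × ]-1, 0[ ⊆ Q(2)` (`𝒞(0,1) ⊆ B(0, √2)`). [folklore] -/
theorem unitParCyl_subset_parabolicCylinder_two :
    parCyl (0 : ℝ × EuclideanSpace ℝ (Fin 3)) 1 ⊆ parabolicCylinder 2 0 := by
  refine (parCyl_subset_parabolicCylinder 0 zero_le_one).trans ?_
  rw [mul_one]
  refine parabolicCylinder_zero_mono (Real.sqrt_nonneg 2) ?_
  rw [show (2 : ℝ) = Real.sqrt (2 ^ 2) by rw [Real.sqrt_sq (by norm_num : (0 : ℝ) ≤ 2)]]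
  exact Real.sqrt_le_sqrt (by norm_num)

/-- **The hypothesis block of Seregin's local theorems from the ball class at scale `2`.** An
Albritton–Barker suitable weak solution `(v, q)` in `Q(2)` restricts to the unit coordinate
cylinder `Q = 𝒞 × ]-1, 0[` with the global classes of Seregin 2020, Def. 1.3:
`v ∈ L_{2,∞}(Q)`, a weak spatial gradient in `L₂(Q)`, `q ∈ L_{3/2}(Q)`. [folklore] -/
theorem parCyl_block_of_inBall
    {v : ℝ → EuclideanSpace ℝ (Fin 3) → EuclideanSpace ℝ (Fin 3)}
    {q : ℝ → EuclideanSpace ℝ (Fin 3) → ℝ} (h : IsSuitableWeakSolutionInBall 2 0 v q) :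
    IsSuitableWeakSolutionOn (parCylOpens 0 1) 1 0 v q ∧
    (∃ C : ℝ≥0, ∀ᵐ t ∂(volume.restrict (Ioo (-1 : ℝ) 0)),
      ∫⁻ x in spaceCyl 0 1, ‖v t x‖ₑ ^ 2 ≤ C) ∧
    (∃ G : ℝ → EuclideanSpace ℝ (Fin 3) → EuclideanSpace ℝ (Fin 3) →L[ℝ] EuclideanSpace ℝ (Fin 3),
      HasWeakSpatialGradientOn (parCylOpens 0 1) v G ∧
      ∫⁻ z in parCyl 0 1, ENNReal.ofReal (frobeniusNormSq (G z.1 z.2)) < ∞) ∧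
    (∫⁻ z in parCyl 0 1, ‖q z.1 z.2‖ₑ ^ (3 / 2 : ℝ) < ∞) := by
  obtain ⟨hsuit, ⟨C, hC⟩, ⟨G, hG, hG2⟩, hp⟩ := h
  have hsub := unitParCyl_subset_parabolicCylinder_two
  have hle : parCylOpens (0 : ℝ × EuclideanSpace ℝ (Fin 3)) 1 ≤ parabolicCylinderOpens 2 0 :=
    fun z hz => hsub hz
  refine ⟨hsuit.of_le hle, ⟨C, ?_⟩, ⟨G, hG.mono hle, (lintegral_mono_set hsub).trans_lt hG2⟩, ?_⟩
  · -- `L_{2,∞}`: smaller time window, smaller space region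
    have hI : Ioo (-1 : ℝ) 0 ⊆
        Ioo ((0 : ℝ × EuclideanSpace ℝ (Fin 3)).1 - 2 ^ 2)
          (0 : ℝ × EuclideanSpace ℝ (Fin 3)).1 := by
      intro t ht
      simp only [Prod.fst_zero, zero_sub, mem_Ioo] at ht ⊢
      exact ⟨by linarith [ht.1], ht.2⟩
    have hB : spaceCyl (0 : EuclideanSpace ℝ (Fin 3)) 1 ⊆
        ball (0 : ℝ × EuclideanSpace ℝ (Fin 3)).2 2 := by
      refine (spaceCyl_subset_ball 0 zero_le_one).trans ?_
      rw [Prod.snd_zero, mul_one]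
      refine ball_subset_ball ?_
      rw [show (2 : ℝ) = Real.sqrt (2 ^ 2) by rw [Real.sqrt_sq (by norm_num : (0 : ℝ) ≤ 2)]]
      exact Real.sqrt_le_sqrt (by norm_num)
    filter_upwards [ae_restrict_of_ae_restrict_of_subset hI hC] with t ht
    exact (lintegral_mono_set hB).trans ht
  · -- `q ∈ L_{3/2}`
    have h1 := hp.eLpNorm_lt_top
    have h32 : (3 / 2 : ℝ≥0∞) ≠ 0 := by simp
    have h32' : (3 / 2 : ℝ≥0∞) ≠ ∞ := ENNReal.div_ne_top (by simp) (by simp)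
    rw [eLpNorm_lt_top_iff_lintegral_rpow_enorm_lt_top h32 h32'] at h1
    have e : ((3 / 2 : ℝ≥0∞)).toReal = (3 / 2 : ℝ) := by
      rw [ENNReal.toReal_div]; norm_num
    rw [e] at h1
    exact (lintegral_mono_set hsub).trans_lt h1

/-! ### Parabolic dilations about the origin -/

/-- The dilated pair `b w(b² s, b y)`, `b² π(b² s, b y)` is again in the ball class at every scale.
[folklore] -/
theorem inBall_zoom_of_forall
    {w : ℝ → EuclideanSpace ℝ (Fin 3) → EuclideanSpace ℝ (Fin 3)}
    {π : ℝ → EuclideanSpace ℝ (Fin 3) → ℝ}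
    (hball : ∀ a : ℝ, 0 < a → IsSuitableWeakSolutionInBall a 0 w π) {b : ℝ} (hb : 0 < b)
    {a : ℝ} (ha : 0 < a) :
    IsSuitableWeakSolutionInBall a 0
      (b • stPull (b ^ 2) b (0 : ℝ) (0 : EuclideanSpace ℝ (Fin 3)) w)
      (b ^ 2 • stPull (b ^ 2) b (0 : ℝ) (0 : EuclideanSpace ℝ (Fin 3)) π) := by
  have h := (hball (b * a) (mul_pos hb ha)).zoomOut hb
  rwa [mul_div_cancel_left₀ a hb.ne'] at h

/-- The dilation about the axis preserves axial symmetry of all slices. [folklore] -/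
theorem isAxisymmetric_zoom
    {w : ℝ → EuclideanSpace ℝ (Fin 3) → EuclideanSpace ℝ (Fin 3)}
    (hax : ∀ s, IsAxisymmetric (w s)) (b s : ℝ) :
    IsAxisymmetric ((b • stPull (b ^ 2) b (0 : ℝ) (0 : EuclideanSpace ℝ (Fin 3)) w) s) := by
  intro θ y
  simp only [smul_stPull_apply, zero_add]
  rw [← rotZ_smul, hax _ θ, rotZ_smul]

/-- **Backward boundedness is dilation invariant**: if the dilated field `b w(b² s, b y)` is
essentially bounded on `Q(z', r)` then `w` is essentially bounded on `Q((b² t', b x'), b r)`.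
[folklore] -/
theorem eLpNorm_lt_top_of_zoom
    {w : ℝ → EuclideanSpace ℝ (Fin 3) → EuclideanSpace ℝ (Fin 3)} {b r : ℝ} (hb : 0 < b)
    {z' : ℝ × EuclideanSpace ℝ (Fin 3)}
    (hfin : eLpNorm (uncurry (b • stPull (b ^ 2) b (0 : ℝ) (0 : EuclideanSpace ℝ (Fin 3)) w)) ∞
      (volume.restrict (parabolicCylinder r z')) < ∞) :
    eLpNorm (uncurry w) ∞
      (volume.restrict (parabolicCylinder (b * r) ((b ^ 2 * z'.1, b • z'.2) : ℝ × _))) < ∞ := by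
  rw [eLpNorm_top_nsZoom hb 0 0 r z' w] at hfin
  have e : stAffine (b ^ 2) b (0 : ℝ) (0 : EuclideanSpace ℝ (Fin 3)) z' =
      (b ^ 2 * z'.1, b • z'.2) := by
    rw [show z' = (z'.1, z'.2) from rfl, stAffine_apply, zero_add, zero_add]
  rw [e] at hfin
  by_contra htop
  rw [not_lt, top_le_iff] at htop
  rw [htop, ENNReal.mul_top (ENNReal.ofReal_pos.2 hb).ne'] at hfin
  exact lt_irrefl _ hfin

/-- **Every point of the closed lower half space is a dilate of a point of `𝒞 × ]-1, 0]`**: for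
`t ≤ 0` and `b > ‖x‖ + √(-t)` (`b > 0`), the point `(t/b², x/b)` has time in `]-1, 0]` and lies in
the unit ball, inside `𝒞(0, 1)`. [folklore] -/
theorem zoomDown_mem {z : ℝ × EuclideanSpace ℝ (Fin 3)} (hz : z.1 ≤ 0) {b : ℝ} (hb : 0 < b)
    (hbz : ‖z.2‖ + Real.sqrt (-z.1) < b) :
    z.1 / b ^ 2 ∈ Ioc (-1 : ℝ) 0 ∧ b⁻¹ • z.2 ∈ spaceCyl (0 : EuclideanSpace ℝ (Fin 3)) 1 := by
  have hb2 : 0 < b ^ 2 := by positivity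
  refine ⟨⟨?_, div_nonpos_of_nonpos_of_nonneg hz hb2.le⟩, ?_⟩
  · -- `-1 < t / b²` since `-t = (√-t)² < b²`
    rw [lt_div_iff₀ hb2]
    have h1 : Real.sqrt (-z.1) < b := by linarith [norm_nonneg z.2]
    have h2 : -z.1 < b ^ 2 := by
      have h3 : Real.sqrt (-z.1) ^ 2 < b ^ 2 := pow_lt_pow_left₀ h1 (Real.sqrt_nonneg _) two_ne_zero
      rwa [Real.sq_sqrt (by linarith)] at h3
    linarith
  · refine Literature.Analysis.FluidPDE.ball_subset_spaceCyl 0 1 ?_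
    rw [mem_ball, dist_zero_right, norm_smul, norm_inv, Real.norm_eq_abs, abs_of_pos hb,
      inv_mul_lt_iff₀ hb]
    linarith [Real.sqrt_nonneg (-z.1), norm_nonneg z.2]

/-- Undoing the dilation: `(b² (t/b²), b (x/b)) = (t, x)`. [folklore] -/
theorem zoomUp_zoomDown (z : ℝ × EuclideanSpace ℝ (Fin 3)) {b : ℝ} (hb : 0 < b) :
    ((b ^ 2 * (z.1 / b ^ 2), b • b⁻¹ • z.2) : ℝ × EuclideanSpace ℝ (Fin 3)) = z := by
  have hb2 : b ^ 2 ≠ 0 := by positivity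
  rw [mul_div_cancel₀ _ hb2, smul_smul, mul_inv_cancel₀ hb.ne', one_smul]

/-! ### The structure theorem -/

/-- **Seregin 2020, proof of Thm 2.1: the backward-singular set of an axisymmetric local energy
ancient solution is closed, lies on the axis and is `𝒫¹`-null, up to the top time.** Let `(w, π)`
be an Albritton–Barker suitable weak solution in every `Q(a)`, `a > 0`, with all slices `w s`
axisymmetric ((𝒜)(i)–(ii)), and let
`Σ = {z = (t, x) | t ≤ 0 ∧ ¬ ∃ r > 0, w ∈ L_∞(Q(z, r))}`. Then `Σ` is closed, `x' = 0` on `Σ`,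
and `𝒫¹(Σ) = 0`.
[cite: Seregin2020, proof of Thm 2.1, structure of S^Γ (arXiv p. 7) and last paragraph] -/
theorem ancientLimit_backwardSingular_structure :
    ∀ (w : ℝ → EuclideanSpace ℝ (Fin 3) → EuclideanSpace ℝ (Fin 3))
      (π : ℝ → EuclideanSpace ℝ (Fin 3) → ℝ), (∀ s, IsAxisymmetric (w s)) →
      (∀ a : ℝ, 0 < a → IsSuitableWeakSolutionInBall a 0 w π) →
      IsClosed {z : ℝ × EuclideanSpace ℝ (Fin 3) | z.1 ≤ 0 ∧
          ¬ ∃ r > 0, eLpNorm (uncurry w) ∞ (volume.restrict (parabolicCylinder r z)) < ∞} ∧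
        (∀ z ∈ {z : ℝ × EuclideanSpace ℝ (Fin 3) | z.1 ≤ 0 ∧
          ¬ ∃ r > 0, eLpNorm (uncurry w) ∞ (volume.restrict (parabolicCylinder r z)) < ∞},
          cylRadius z.2 = 0) ∧
        IsParabolicNull 1 {z : ℝ × EuclideanSpace ℝ (Fin 3) | z.1 ≤ 0 ∧
          ¬ ∃ r > 0, eLpNorm (uncurry w) ∞ (volume.restrict (parabolicCylinder r z)) < ∞} := by
  intro w π hax hball
  -- ### dilations: the block on `𝒞 × ]-1, 0[` for `b w(b² s, b y)`, and the transfer of boundedness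
  have hblock : ∀ b : ℝ, 0 < b →
      IsSuitableWeakSolutionOn (parCylOpens 0 1) 1 0
          (b • stPull (b ^ 2) b (0 : ℝ) (0 : EuclideanSpace ℝ (Fin 3)) w)
          (b ^ 2 • stPull (b ^ 2) b (0 : ℝ) (0 : EuclideanSpace ℝ (Fin 3)) π) ∧
        (∃ C : ℝ≥0, ∀ᵐ t ∂(volume.restrict (Ioo (-1 : ℝ) 0)),
          ∫⁻ x in spaceCyl 0 1,
            ‖(b • stPull (b ^ 2) b (0 : ℝ) (0 : EuclideanSpace ℝ (Fin 3)) w) t x‖ₑ ^ 2 ≤ C) ∧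
        (∃ G : ℝ → EuclideanSpace ℝ (Fin 3) →
            EuclideanSpace ℝ (Fin 3) →L[ℝ] EuclideanSpace ℝ (Fin 3),
          HasWeakSpatialGradientOn (parCylOpens 0 1)
              (b • stPull (b ^ 2) b (0 : ℝ) (0 : EuclideanSpace ℝ (Fin 3)) w) G ∧
            ∫⁻ z in parCyl 0 1, ENNReal.ofReal (frobeniusNormSq (G z.1 z.2)) < ∞) ∧
        (∫⁻ z in parCyl 0 1,
          ‖(b ^ 2 • stPull (b ^ 2) b (0 : ℝ) (0 : EuclideanSpace ℝ (Fin 3)) π) z.1 z.2‖ₑ ^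
            (3 / 2 : ℝ) < ∞) :=
    fun b hb => parCyl_block_of_inBall (inBall_zoom_of_forall hball hb two_pos)
  -- a point `z` of the lower half space, its scale `b z` and its dilate `z ↓`
  have key : ∀ z : ℝ × EuclideanSpace ℝ (Fin 3), z.1 ≤ 0 → ∀ b : ℝ, ‖z.2‖ + Real.sqrt (-z.1) < b →
      0 < b →
      (¬ ∃ r > 0, eLpNorm (uncurry w) ∞ (volume.restrict (parabolicCylinder r z)) < ∞) →
      ¬ ∃ r > 0, eLpNorm (uncurry (b • stPull (b ^ 2) b (0 : ℝ) (0 : EuclideanSpace ℝ (Fin 3)) w)) ∞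
        (volume.restrict (parabolicCylinder r ((z.1 / b ^ 2, b⁻¹ • z.2) : ℝ × _))) < ∞ := by
    rintro z hz b hbz hb hsing ⟨r, hr, hfin⟩
    refine hsing ⟨b * r, mul_pos hb hr, ?_⟩
    have h := eLpNorm_lt_top_of_zoom hb hfin
    rwa [zoomUp_zoomDown z hb] at h
  refine ⟨?_, fun z hz => ?_, ?_⟩
  · -- ### closedness: the complement is open
    rw [← isOpen_compl_iff, Metric.isOpen_iff]
    intro z hz
    rw [mem_compl_iff, mem_setOf_eq, not_and, not_not] at hz
    by_cases hz0 : 0 < z.1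
    · -- above the top time
      refine ⟨z.1, hz0, fun y hy hyS => ?_⟩
      have h1 : |y.1 - z.1| < z.1 := by
        rw [mem_ball, Prod.dist_eq, max_lt_iff] at hy
        rw [← Real.dist_eq]; exact hy.1
      rw [abs_lt] at h1
      exact absurd hyS.1 (by linarith)
    · push Not at hz0
      obtain ⟨r, hr, hfin⟩ := hz hz0
      rcases hz0.lt_or_eq with hlt | heq
      · -- interior point: centred regularity, then nesting of cylinders
        set a : ℝ := ‖z.2‖ + Real.sqrt (-z.1) + 1 with ha
        have hapos : 0 < a := by positivity
        have hzQ : z ∈ (parabolicCylinderOpens a (0 : ℝ × EuclideanSpace ℝ (Fin 3)) : Set _) := by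
          rw [coe_parabolicCylinderOpens, mem_parabolicCylinder]
          simp only [Prod.fst_zero, Prod.snd_zero, zero_sub, dist_zero_right]
          have h2 : -z.1 < a ^ 2 := by
            have h3 : Real.sqrt (-z.1) < a := by rw [ha]; linarith [norm_nonneg z.2]
            have h4 : Real.sqrt (-z.1) ^ 2 < a ^ 2 :=
              pow_lt_pow_left₀ h3 (Real.sqrt_nonneg _) two_ne_zero
            rwa [Real.sq_sqrt (by linarith)] at h4
          exact ⟨⟨by linarith, hlt⟩, by rw [ha]; linarith [Real.sqrt_nonneg (-z.1)]⟩
        -- a small backward cylinder inside `Q(a)`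
        obtain ⟨ε, hε, hεsub⟩ := Metric.isOpen_iff.1 (isOpen_parabolicCylinder a 0) z hzQ
        set r' : ℝ := min (min r ε) 1 with hr'
        have hr'pos : 0 < r' := lt_min (lt_min hr hε) one_pos
        have hr'r : r' ≤ r := (min_le_left _ _).trans (min_le_left _ _)
        have hr'ε : r' ≤ ε := (min_le_left _ _).trans (min_le_right _ _)
        have hr'1 : r' ≤ 1 := min_le_right _ _
        have hQsub : parabolicCylinder r' z ⊆
            (parabolicCylinderOpens a (0 : ℝ × EuclideanSpace ℝ (Fin 3)) : Set _) := by
          intro y hy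
          refine hεsub ?_
          rw [mem_parabolicCylinder] at hy
          rw [mem_ball, Prod.dist_eq, max_lt_iff, Real.dist_eq]
          have h1 : r' ^ 2 ≤ r' := by nlinarith
          refine ⟨?_, hy.2.trans_le hr'ε⟩
          rw [abs_lt]; constructor <;> linarith [hy.1.1, hy.1.2]
        have hfin' : eLpNorm (uncurry w) ∞ (volume.restrict (parabolicCylinder r' z)) < ∞ :=
          (eLpNorm_mono_measure _ (Measure.restrict_mono
            (parabolicCylinder_mono hr'pos.le hr'r z) le_rfl)).trans_lt hfin
        obtain ⟨ρ, hρ, hρfin⟩ := isRegularPoint_of_eLpNorm_parabolicCylinder_lt_top_holds _ w π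
          (hball a hapos).1 z hzQ r' hr'pos hQsub hfin'
        refine ⟨min (ρ ^ 2 / 4) (ρ / 2), lt_min (by positivity) (by positivity), fun y hy hyS => ?_⟩
        rw [mem_ball, Prod.dist_eq, max_lt_iff, Real.dist_eq, lt_min_iff, lt_min_iff] at hy
        refine hyS.2 ⟨ρ / 2, by positivity,
          (eLpNorm_mono_measure _ (Measure.restrict_mono ?_ le_rfl)).trans_lt hρfin⟩
        intro v hv
        rw [mem_parabolicCylinder] at hv
        rw [mem_parabolicCylinderCentered]
        have h1 := hy.1.1
        rw [abs_lt] at h1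
        refine ⟨⟨by nlinarith [hv.1.1, h1.1], by nlinarith [hv.1.2, h1.2]⟩, ?_⟩
        calc dist v.2 z.2 ≤ dist v.2 y.2 + dist y.2 z.2 := dist_triangle _ _ _
          _ < ρ / 2 + ρ / 2 := add_lt_add hv.2 hy.2.2
          _ = ρ := by ring
      · -- top point: nesting of backward cylinders
        refine ⟨min (r ^ 2 / 2) (r / 2), lt_min (by positivity) (by positivity), fun y hy hyS => ?_⟩
        rw [mem_ball, Prod.dist_eq, max_lt_iff, Real.dist_eq, lt_min_iff, lt_min_iff] at hy
        refine hyS.2 ⟨r / 2, by positivity,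
          (eLpNorm_mono_measure _ (Measure.restrict_mono ?_ le_rfl)).trans_lt hfin⟩
        intro v hv
        rw [mem_parabolicCylinder] at hv ⊢
        have h1 := hy.1.1
        rw [abs_lt] at h1
        have hy0 : y.1 ≤ 0 := hyS.1
        refine ⟨⟨by nlinarith [hv.1.1, h1.1], by linarith [hv.1.2]⟩, ?_⟩
        calc dist v.2 z.2 ≤ dist v.2 y.2 + dist y.2 z.2 := dist_triangle _ _ _
          _ < r / 2 + r / 2 := add_lt_add hv.2 hy.2.2
          _ = r := by ring
  · -- ### on the axis: off-axis points are backward regular up to the top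
    obtain ⟨hz0, hsing⟩ := hz
    by_contra hoff
    set b : ℝ := ‖z.2‖ + Real.sqrt (-z.1) + 1 with hb
    have hbpos : 0 < b := by positivity
    have hbz : ‖z.2‖ + Real.sqrt (-z.1) < b := by rw [hb]; linarith
    obtain ⟨ht', hx'⟩ := zoomDown_mem hz0 hbpos hbz
    obtain ⟨hsw, hA, ⟨G, hG, hE⟩, hq⟩ := hblock b hbpos
    have hoff' : 0 < cylRadius (b⁻¹ • z.2) := by
      rw [cylRadius_smul, abs_of_pos (inv_pos.2 hbpos)]
      exact mul_pos (inv_pos.2 hbpos) ((cylRadius_nonneg _).lt_of_ne (Ne.symm hoff))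
    obtain ⟨r, hr, hfin⟩ := offAxis_regular hsw hA hG hE hq
      (fun t _ => isAxisymmetric_zoom hax b t) (z₁ := (z.1 / b ^ 2, b⁻¹ • z.2)) ht' hx' hoff'
    exact key z hz0 b hbz hbpos hsing ⟨r, hr, hfin⟩
  · -- ### `𝒫¹`-nullity: a countable union of dilated `𝒫¹`-null sets
    set T : ℕ → Set (ℝ × EuclideanSpace ℝ (Fin 3)) := fun n =>
      {z' | z'.1 ∈ Ioc (-1 : ℝ) 0 ∧ z'.2 ∈ spaceCyl (0 : EuclideanSpace ℝ (Fin 3)) 1 ∧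
        ¬ ∃ r > 0, eLpNorm (uncurry (((n : ℝ) + 1) • stPull (((n : ℝ) + 1) ^ 2) ((n : ℝ) + 1)
          (0 : ℝ) (0 : EuclideanSpace ℝ (Fin 3)) w)) ∞
            (volume.restrict (parabolicCylinder r z')) < ∞}
      with hT
    have hTnull : ∀ n : ℕ, IsParabolicNull 1 (T n) := by
      intro n
      have hn : (0 : ℝ) < (n : ℝ) + 1 := by positivity
      obtain ⟨hsw, hA, ⟨G, hG, hE⟩, hq⟩ := hblock _ hn
      exact isParabolicNull_backwardSingular_top _ _ G hsw hA hG hE hq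
    have himg : ∀ n : ℕ, IsParabolicNull 1
        (stAffine (((n : ℝ) + 1) ^ 2) ((n : ℝ) + 1) (0 : ℝ)
          (0 : EuclideanSpace ℝ (Fin 3)) '' T n) :=
      fun n => (hTnull n).image_stAffine (by positivity) (by positivity) _ _
    have hcover : {z : ℝ × EuclideanSpace ℝ (Fin 3) | z.1 ≤ 0 ∧
        ¬ ∃ r > 0, eLpNorm (uncurry w) ∞ (volume.restrict (parabolicCylinder r z)) < ∞} ⊆
        ⋃ n : ℕ, stAffine (((n : ℝ) + 1) ^ 2) ((n : ℝ) + 1) (0 : ℝ)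
          (0 : EuclideanSpace ℝ (Fin 3)) '' T n := by
      rintro z ⟨hz0, hsing⟩
      obtain ⟨n, hn⟩ := exists_nat_gt (‖z.2‖ + Real.sqrt (-z.1))
      have hb : (0 : ℝ) < (n : ℝ) + 1 := by positivity
      have hbz : ‖z.2‖ + Real.sqrt (-z.1) < (n : ℝ) + 1 := by linarith
      refine mem_iUnion.2 ⟨n, ⟨(z.1 / ((n : ℝ) + 1) ^ 2, ((n : ℝ) + 1)⁻¹ • z.2), ?_, ?_⟩⟩
      · obtain ⟨ht', hx'⟩ := zoomDown_mem hz0 hb hbz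
        exact ⟨ht', hx', key z hz0 _ hbz hb hsing⟩
      · rw [stAffine_apply, zero_add, zero_add]
        exact zoomUp_zoomDown z hb
    refine IsParabolicNull.mono ?_ hcover
    refine le_antisymm ?_ bot_le
    calc parabolicHausdorff 1 (⋃ n : ℕ, stAffine (((n : ℝ) + 1) ^ 2) ((n : ℝ) + 1) (0 : ℝ)
            (0 : EuclideanSpace ℝ (Fin 3)) '' T n)
        ≤ ∑' n : ℕ, parabolicHausdorff 1 (stAffine (((n : ℝ) + 1) ^ 2) ((n : ℝ) + 1) (0 : ℝ)
            (0 : EuclideanSpace ℝ (Fin 3)) '' T n) := parabolicHausdorff_iUnion_le_holds 1 _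
      _ = 0 := ENNReal.tsum_eq_zero.2 fun n => himg n

end Summit.NavierStokesRegularity.NavierStokesRegularity.Theorems.AxisymmetricKatoGlobal.EulerScaling

end
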